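import Mathlib.Analysis.Convolution
import Mathlib.Analysis.InnerProductSpace.Calculus
import Summits.AnomalousDissipation.AnomalousDissipation.Theorems.MarginalStabilityChainBurgersLayerLowReGreen

/-!
# Route MarginalStabilityChain · BurgersLayerLowRe — uniqueness and symmetry of the Green operator

Helper file (supports stmt-AnomalousDissipation-3010, `BurgersLayerLowRe`), continuing
`MarginalStabilityChainBurgersLayerLowReGreen`:

* `eq_zero_of_bounded_solution` — a bounded `C²` solution of `d'' = α² d` (`α > 0`) on the line
  vanishes (the slope `⟪d, d'⟫` of `‖d‖²/2` is monotone, so a nonzero slope makes the bounded function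
  `‖d‖²` blow up at `+∞` or at `−∞`);
* `eq_green_of_bounded` — hence every bounded `C²` solution of `g'' = α² g − φ` IS the Green potential
  `(2α)⁻¹ ∫ e^{−α|y−s|} φ(s) ds`;
* `integral_mul_green_comm` — the symmetry `∫ g · Tφ = ∫ Tg · φ` (Fubini; the kernel is symmetric).

All folklore (variation of constants / Fubini).
-/

noncomputable section

open MeasureTheory Set Filter Topology
open scoped Real RealInnerProductSpace Interval

namespace Summit.AnomalousDissipation.AnomalousDissipation.Theorems.MarginalStabilityChainBurgersLayerLowRe

-- the summit and its single sub-problem share the name `AnomalousDissipation` (tree layout D-0017)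
set_option linter.dupNamespace false

section Unique

variable {α : ℝ} {φ : ℝ → ℂ} {M : ℝ}

/-! ### Bounded solutions of `d'' = α² d` vanish -/

/-- A differentiable real function with nonnegative derivative bounded below by `κ > 0` on `[y₀, ∞)`
is unbounded above: `F y ≥ F y₀ + κ (y − y₀)` for `y ≥ y₀`. [folklore] -/
theorem le_of_deriv_ge {F F' : ℝ → ℝ} (hF : ∀ y, HasDerivAt F (F' y) y) {κ y₀ : ℝ}
    (hκ : ∀ y, y₀ ≤ y → κ ≤ F' y) {y : ℝ} (hy : y₀ ≤ y) : F y₀ + κ * (y - y₀) ≤ F y := by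
  have hmono : MonotoneOn (fun u => F u - κ * u) (Ici y₀) := by
    refine monotoneOn_of_hasDerivWithinAt_nonneg (f' := fun u => F' u - κ * 1) (convex_Ici y₀) (fun u _ => ?_)
      (fun u _ => ?_) (fun u hu => ?_)
    · exact ((hF u).sub ((hasDerivAt_id u).const_mul κ)).continuousAt.continuousWithinAt
    · exact ((hF u).sub ((hasDerivAt_id u).const_mul κ)).hasDerivWithinAt
    · rw [interior_Ici] at hu
      simp only [mul_one, sub_nonneg]
      exact hκ u (le_of_lt hu)
  have h := hmono (self_mem_Ici) (mem_Ici.2 hy) hy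
  simp only at h
  linarith

/-- Mirror image of `le_of_deriv_ge`: derivative `≤ −κ < 0` on `(−∞, y₀]` forces
`F y ≥ F y₀ + κ (y₀ − y)` for `y ≤ y₀`. [folklore] -/
theorem le_of_deriv_le {F F' : ℝ → ℝ} (hF : ∀ y, HasDerivAt F (F' y) y) {κ y₀ : ℝ}
    (hκ : ∀ y, y ≤ y₀ → F' y ≤ -κ) {y : ℝ} (hy : y ≤ y₀) : F y₀ + κ * (y₀ - y) ≤ F y := by
  have hanti : AntitoneOn (fun u => F u + κ * u) (Iic y₀) := by
    refine antitoneOn_of_hasDerivWithinAt_nonpos (f' := fun u => F' u + κ * 1) (convex_Iic y₀) (fun u _ => ?_)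
      (fun u _ => ?_) (fun u hu => ?_)
    · exact ((hF u).add ((hasDerivAt_id u).const_mul κ)).continuousAt.continuousWithinAt
    · exact ((hF u).add ((hasDerivAt_id u).const_mul κ)).hasDerivWithinAt
    · rw [interior_Iic] at hu
      simp only [mul_one]
      linarith [hκ u (le_of_lt hu)]
  have h := hanti (mem_Iic.2 hy) (self_mem_Iic) hy
  simp only at h
  linarith

/-- **Bounded solutions of `d'' = α² d` on the line vanish** (`α > 0`). Proof: `q = ⟪d, d'⟫` has
derivative `α²‖d‖² + ‖d'‖² ≥ 0`, and `‖d‖²` has derivative `2q`; a nonzero value of the monotone `q`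
would make `‖d‖²` unbounded. [folklore] -/
theorem eq_zero_of_bounded_solution (hα : 0 < α) {d d' : ℝ → ℂ} (hd : ∀ y, HasDerivAt d (d' y) y)
    (hd' : ∀ y, HasDerivAt d' ((α : ℂ) ^ 2 * d y) y) {B : ℝ} (hB : ∀ y, ‖d y‖ ≤ B) : ∀ y, d y = 0 := by
  -- the real quantities
  set F : ℝ → ℝ := fun y => ‖d y‖ ^ 2 with hF
  set q : ℝ → ℝ := fun y => ⟪d y, d' y⟫ with hq
  have hsmul : ∀ y, (α : ℂ) ^ 2 * d y = (α ^ 2 : ℝ) • d y := fun y => by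
    rw [Complex.real_smul]; push_cast; ring
  have hFd : ∀ y, HasDerivAt F (2 * q y) y := fun y => (hd y).norm_sq
  have hqd : ∀ y, HasDerivAt q (α ^ 2 * ‖d y‖ ^ 2 + ‖d' y‖ ^ 2) y := fun y => by
    have h := (hd y).inner ℝ (hd' y)
    refine h.congr_deriv ?_
    rw [hsmul, real_inner_smul_right, real_inner_self_eq_norm_sq, real_inner_self_eq_norm_sq]
  have hq_nonneg : ∀ y, 0 ≤ α ^ 2 * ‖d y‖ ^ 2 + ‖d' y‖ ^ 2 := fun y => by positivity
  have hqmono : Monotone q := by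
    have h := monotoneOn_of_hasDerivWithinAt_nonneg convex_univ
      (fun u _ => (hqd u).continuousAt.continuousWithinAt) (fun u _ => (hqd u).hasDerivWithinAt)
      (fun u _ => hq_nonneg u)
    exact fun a b hab => h (mem_univ a) (mem_univ b) hab
  have hFB : ∀ y, F y ≤ B ^ 2 := fun y => by
    have := hB y
    have h0 : 0 ≤ ‖d y‖ := norm_nonneg _
    show ‖d y‖ ^ 2 ≤ B ^ 2
    nlinarith
  have hF0 : ∀ y, 0 ≤ F y := fun y => by positivity
  -- `q` vanishes identically
  have hq0 : ∀ y₀, q y₀ = 0 := by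
    intro y₀
    by_contra hne
    rcases lt_or_gt_of_ne hne with hneg | hpos
    · -- negative slope: blow-up at `−∞`
      set κ := -(2 * q y₀) with hκ
      have hκpos : 0 < κ := by rw [hκ]; linarith
      have hle : ∀ y, y ≤ y₀ → 2 * q y ≤ -κ := fun y hy => by
        rw [hκ, neg_neg]; linarith [hqmono hy]
      set y := y₀ - (B ^ 2 + 1) / κ with hy
      have hyle : y ≤ y₀ := by
        rw [hy]; have : 0 ≤ (B ^ 2 + 1) / κ := by positivity
        linarith
      have h := le_of_deriv_le hFd hle hyle
      have hprod : κ * (y₀ - y) = B ^ 2 + 1 := by rw [hy]; field_simp; ring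
      linarith [hFB y, hF0 y₀]
    · -- positive slope: blow-up at `+∞`
      set κ := 2 * q y₀ with hκ
      have hκpos : 0 < κ := by rw [hκ]; linarith
      have hge : ∀ y, y₀ ≤ y → κ ≤ 2 * q y := fun y hy => by
        rw [hκ]; linarith [hqmono hy]
      set y := y₀ + (B ^ 2 + 1) / κ with hy
      have hyge : y₀ ≤ y := by
        rw [hy]; have : 0 ≤ (B ^ 2 + 1) / κ := by positivity
        linarith
      have h := le_of_deriv_ge hFd hge hyge
      have hprod : κ * (y - y₀) = B ^ 2 + 1 := by rw [hy]; field_simp; ring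
      linarith [hFB y, hF0 y₀]
  -- hence its derivative vanishes, i.e. `d = 0`
  intro y
  have hderiv : α ^ 2 * ‖d y‖ ^ 2 + ‖d' y‖ ^ 2 = 0 := by
    have h1 : HasDerivAt q 0 y := by
      have : q = fun _ => 0 := funext hq0
      rw [this]; exact hasDerivAt_const y 0
    exact (hqd y).unique h1
  have h2 : α ^ 2 * ‖d y‖ ^ 2 = 0 := by nlinarith [sq_nonneg ‖d' y‖, sq_nonneg ‖d y‖, hderiv]
  have h3 : ‖d y‖ ^ 2 = 0 := by
    rcases mul_eq_zero.1 h2 with h | h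
    · exact absurd h (by positivity)
    · exact h
  exact norm_eq_zero.1 (pow_eq_zero_iff two_ne_zero |>.1 h3)

variable {T : ℝ → ℂ}

/-- **Bounded solutions of `g'' = α² g − φ` are the Green potential.** [folklore] -/
theorem eq_green_of_bounded (hα : 0 < α) (hφ : Continuous φ) (hM : ∀ s, ‖φ s‖ ≤ M)
    (hT : T = fun y => (2 * (α : ℂ))⁻¹ * ∫ s, ((Real.exp (-(α * |y - s|)) : ℝ) : ℂ) * φ s)
    {g g' : ℝ → ℂ} (hg : ∀ y, HasDerivAt g (g' y) y) (hg' : ∀ y, HasDerivAt g' ((α : ℂ) ^ 2 * g y - φ y) y)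
    {B : ℝ} (hB : ∀ y, ‖g y‖ ≤ B) : g = T := by
  obtain ⟨T', hT1, hT2, -⟩ := green_hasDerivAt hα hφ hM hT
  have hd : ∀ y, HasDerivAt (fun u => g u - T u) (g' y - T' y) y := fun y => (hg y).sub (hT1 y)
  have hd' : ∀ y, HasDerivAt (fun u => g' u - T' u) ((α : ℂ) ^ 2 * (g y - T y)) y := fun y =>
    ((hg' y).sub (hT2 y)).congr_deriv (by ring)
  have hbd : ∀ y, ‖g y - T y‖ ≤ B + M / α ^ 2 := fun y =>
    (norm_sub_le _ _).trans (add_le_add (hB y) (green_norm_le hα hφ hM hT y))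
  have h0 := eq_zero_of_bounded_solution hα hd hd' hbd
  funext y
  exact sub_eq_zero.1 (h0 y)

/-! ### Symmetry of the Green operator -/

/-- **`∫ g · (Tφ) = ∫ (Tg) · φ`** for integrable `φ` and bounded continuous `g` (Fubini: the kernel
`e^{−α|y−s|}` is symmetric and the double integral converges absolutely). [folklore] -/
theorem integral_mul_green_comm (hα : 0 < α) {g : ℝ → ℂ} {Mg : ℝ}
    (hφi : Integrable φ) (hg : Continuous g) (hMg : ∀ s, ‖g s‖ ≤ Mg) :
    ∫ y, g y * ((2 * (α : ℂ))⁻¹ * ∫ s, ((Real.exp (-(α * |y - s|)) : ℝ) : ℂ) * φ s) =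
      ∫ s, ((2 * (α : ℂ))⁻¹ * ∫ y, ((Real.exp (-(α * |s - y|)) : ℝ) : ℂ) * g y) * φ s := by
  set k : ℝ → ℂ := fun t => ((Real.exp (-(α * |t|)) : ℝ) : ℂ) with hk
  have hki : Integrable k := by
    have h := (integrable_kernel hα 0).ofReal (𝕜 := ℂ)
    refine h.congr (Eventually.of_forall fun t => ?_)
    simp [hk, zero_sub, abs_neg]
  -- absolute convergence of the double integral
  have hprod : Integrable (fun p : ℝ × ℝ => φ p.2 * k (p.1 - p.2)) (volume.prod volume) :=
    hφi.convolution_integrand (ContinuousLinearMap.mul ℝ ℂ) hki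
  have hF : Integrable (Function.uncurry fun y s => g y * (φ s * k (y - s))) (volume.prod volume) := by
    have h := hprod.bdd_mul (c := Mg) ((hg.comp continuous_fst).aestronglyMeasurable)
      (Eventually.of_forall fun p => hMg p.1)
    exact h
  have hswap := integral_integral_swap hF
  -- identify both sides
  have hL : ∀ y, ∫ s, g y * (φ s * k (y - s)) = g y * ∫ s, ((Real.exp (-(α * |y - s|)) : ℝ) : ℂ) * φ s := by
    intro y
    rw [integral_const_mul]
    congr 1
    refine integral_congr_ae (Eventually.of_forall fun s => ?_)
    simp only [hk]; ring
  have hR : ∀ s, ∫ y, g y * (φ s * k (y - s)) = (∫ y, ((Real.exp (-(α * |s - y|)) : ℝ) : ℂ) * g y) * φ s := by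
    intro s
    rw [← integral_mul_const]
    refine integral_congr_ae (Eventually.of_forall fun y => ?_)
    simp only [hk]; rw [abs_sub_comm]; ring
  simp_rw [hL, hR] at hswap
  calc ∫ y, g y * ((2 * (α : ℂ))⁻¹ * ∫ s, ((Real.exp (-(α * |y - s|)) : ℝ) : ℂ) * φ s)
      = (2 * (α : ℂ))⁻¹ * ∫ y, g y * ∫ s, ((Real.exp (-(α * |y - s|)) : ℝ) : ℂ) * φ s := by
        rw [← integral_const_mul]; congr 1; funext y; ring
    _ = (2 * (α : ℂ))⁻¹ * ∫ s, (∫ y, ((Real.exp (-(α * |s - y|)) : ℝ) : ℂ) * g y) * φ s := by rw [hswap]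
    _ = ∫ s, ((2 * (α : ℂ))⁻¹ * ∫ y, ((Real.exp (-(α * |s - y|)) : ℝ) : ℂ) * g y) * φ s := by
        rw [← integral_const_mul]; congr 1; funext s; ring

end Unique

end Summit.AnomalousDissipation.AnomalousDissipation.Theorems.MarginalStabilityChainBurgersLayerLowRe
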